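import Summits.Ventures.PercRepro.Night2LocalTwoTwoX

/-!
# PercRepro — counting lemmas for simple planes, II: collinear triples (night-2, gen 9)

Two collinear triples of a set without a collinear `4`-subset share at most one element (if they shared two
elements `e ≠ f` of rank `2`, their union would lie in `cl {e, f}` and have rank `2`).
-/

namespace PercRepro.Shadow

open Finset PerFlat ThmH

variable {α : Type*} [DecidableEq α] {M : Matroid α} [M.Finite]

/-- **Two collinear sets sharing two elements are collinear together**: if `T₁`, `T₂` have rank `≤ 2` and share
two elements of rank `2`, then `T₁ ∪ T₂` has rank `≤ 2` (so two collinear triples of a set without a collinear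
`4`-subset share at most one element). -/
theorem rkN_union_le_two_of_two_le_card_inter {T₁ T₂ : Finset α}
    (h1 : rkN M T₁ ≤ 2) (h2 : rkN M T₂ ≤ 2) (hsimple : ∀ e ∈ T₁ ∩ T₂, ∀ f ∈ T₁ ∩ T₂, e ≠ f → rkN M {e, f} = 2)
    (hint : 2 ≤ (T₁ ∩ T₂).card) : rkN M (T₁ ∪ T₂) ≤ 2 := by
  have hsub := rkN_inter_add_rkN_union_le (M := M) T₁ T₂
  obtain ⟨e, he, f, hf, hef⟩ := Finset.one_lt_card.1 (by omega : 1 < (T₁ ∩ T₂).card)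
  have hpair : rkN M {e, f} ≤ rkN M (T₁ ∩ T₂) := rkN_mono (by
    intro y hy
    rw [Finset.mem_insert, Finset.mem_singleton] at hy
    rcases hy with rfl | rfl
    · exact he
    · exact hf)
  rw [hsimple e he f hf hef] at hpair
  omega

/-- Two distinct collinear triples of a set without a collinear `4`-subset share at most one element. -/
theorem card_inter_le_one_of_collinear_triples {U T₁ T₂ : Finset α}
    (hsimple : ∀ e ∈ U, ∀ f ∈ U, e ≠ f → rkN M {e, f} = 2)
    (hno4 : ∀ V ⊆ U, V.card = 4 → 3 ≤ rkN M V)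
    (hT₁ : T₁ ⊆ U) (hT₂ : T₂ ⊆ U) (hc₁ : T₁.card = 3) (hc₂ : T₂.card = 3) (hr₁ : rkN M T₁ ≤ 2)
    (hr₂ : rkN M T₂ ≤ 2) (hne : T₁ ≠ T₂) : (T₁ ∩ T₂).card ≤ 1 := by
  by_contra h
  push Not at h
  have hcu := Finset.card_union_add_card_inter T₁ T₂
  have hle : (T₁ ∩ T₂).card ≤ 2 := by
    by_contra h3
    push Not at h3
    have : T₁ ∩ T₂ = T₁ := Finset.eq_of_subset_of_card_le Finset.inter_subset_left (by omega)
    have h12 : T₁ ⊆ T₂ := by rw [← this]; exact Finset.inter_subset_right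
    exact hne (Finset.eq_of_subset_of_card_le h12 (by omega))
  have hunion : rkN M (T₁ ∪ T₂) ≤ 2 :=
    rkN_union_le_two_of_two_le_card_inter hr₁ hr₂
      (fun e he f hf hef => hsimple e (hT₁ (Finset.mem_inter.1 he).1) f (hT₁ (Finset.mem_inter.1 hf).1) hef)
      (by omega)
  have := hno4 (T₁ ∪ T₂) (Finset.union_subset hT₁ hT₂) (by omega)
  omega

/-- **At most two collinear triples**: a `5`-element set of pairwise-rank-`2` elements without a collinear
`4`-subset contains at most two collinear triples. -/
theorem card_collinear_triples_le_two {U : Finset α}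
    (hsimple : ∀ e ∈ U, ∀ f ∈ U, e ≠ f → rkN M {e, f} = 2) (h5 : U.card = 5)
    (hno4 : ∀ V ⊆ U, V.card = 4 → 3 ≤ rkN M V) :
    ((U.powersetCard 3).filter (fun T => rkN M T ≤ 2)).card ≤ 2 := by
  by_contra h
  push Not at h
  obtain ⟨T₁, h₁, T₂, h₂, T₃, h₃, h12, h13, h23⟩ := Finset.two_lt_card.1 h
  simp only [Finset.mem_filter, Finset.mem_powersetCard] at h₁ h₂ h₃
  have i12 := card_inter_le_one_of_collinear_triples hsimple hno4 h₁.1.1 h₂.1.1 h₁.1.2 h₂.1.2 h₁.2 h₂.2 h12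
  have i13 := card_inter_le_one_of_collinear_triples hsimple hno4 h₁.1.1 h₃.1.1 h₁.1.2 h₃.1.2 h₁.2 h₃.2 h13
  have i23 := card_inter_le_one_of_collinear_triples hsimple hno4 h₂.1.1 h₃.1.1 h₂.1.2 h₃.1.2 h₂.2 h₃.2 h23
  -- `T₁ ∪ T₂ = U`
  have hcu := Finset.card_union_add_card_inter T₁ T₂
  have hU : T₁ ∪ T₂ = U := by
    apply Finset.eq_of_subset_of_card_le (Finset.union_subset h₁.1.1 h₂.1.1)
    omega
  -- `T₃ ⊆ T₁ ∪ T₂`, so `|T₃| ≤ |T₃ ∩ T₁| + |T₃ ∩ T₂|`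
  have hsplit : T₃ = (T₃ ∩ T₁) ∪ (T₃ ∩ T₂) := by
    rw [← Finset.inter_union_distrib_left, hU]
    exact (Finset.inter_eq_left.2 h₃.1.1).symm
  have hc : T₃.card ≤ (T₃ ∩ T₁).card + (T₃ ∩ T₂).card := by
    calc T₃.card = ((T₃ ∩ T₁) ∪ (T₃ ∩ T₂)).card := by rw [← hsplit]
      _ ≤ (T₃ ∩ T₁).card + (T₃ ∩ T₂).card := Finset.card_union_le _ _
  rw [Finset.inter_comm T₃ T₁, Finset.inter_comm T₃ T₂] at hc
  omega

end PercRepro.Shadow
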